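import Summits.QuantumFields.YangMills.Theorems.UnitScaleTiltProp7V0CurrentRealityT3
import HarnessLib

/-!
# Route `UnitScaleTilt`, crux K1 child «MinimiserStabilityRegPr» (stmt-QuantumFields-19200), stub `stub_existenceMinimalOrbit` (EX), route (α) — **LIFT-THREAD 2, SED-TWIN T1∕D12 (a): THE FAMILY ROW
# `hV0` FROM `hRC`, UNDER THE `Lift L i U₀` ANTECEDENT** — the v1 door ✓`Prop7V0CurrentReality.hV0_of_RC_family` (file `…V0CurrentRealityT3`; first refusal released px3 g10 17:25:30Z) with the
# opaque lift predicate threaded: token `Lift L i U₀ →` after the `RegPr … (α L) U₀ →` clause of the consumed row `hRC` AND of the conclusion `hV0` (op → op pass-through).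

WHY.  px12 g11's LOCATE d8153c1b72719070: the displayed N06 row `hPcol` of S42ᴸ, asked for EVERY `U₀ ∈ RegPr ρ`, is not inhabitable on stratum (c) (✓p734809 `PcolImpliesNSPoincare`); repair (A)
of record (★★OWNER RULING №30; namer ★w2-19200 g9 17:13:49Z ∕ PEN ASSIGNMENT v1 17:22:48Z «w8 g12: D11 + D12, then D13»; px12 g11 SED LIST v0 2bd9ff01b2ba680a) = every print row, and every row
derived from one, is asked only for backgrounds `U₀` satisfying `Lift L i U₀` (the top-level parallel sections lift — the class of the record minimiser, where the rows are consumed; discharged at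
the junction by ✓`Prop7IrrLiftRowOfRecord.hIrrLift_of_record`).
`hRC` descends from the print row `norm_Hπ` (door D11), so it carries the antecedent and so does `hV0`.
TOKEN CONVENTION (α)(β)(γ) of record (routeR-w6 g11 17:24:52Z, namer ★w2-19200 g9 «AGREED» 17:25:31Z): (α) the door carries the OPAQUE predicate binder `(Lift : ∀ L i, GaugeField … → Prop)` as its first explicit binder and the token `Lift L i U₀ →` (only the S-files instantiate `Lift :=` the 6-line clause of SIGNATURE-0 S43ᴸT2 532e4a648d626dc4); (β) the token sits immediately after the last regularity guard of each threaded row (`RegPr … (α L) U₀ →` ∕ `ρ ≤ α L →`); (γ) file∕namespace = v1 + `Lift`, theorem names unchanged.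
Statement = v1's VERBATIM but for the `Lift` binder and the two tokens; proof = v1's VERBATIM but for `intro … hLift …` and `hRC … hreg hLift`; the member theorem
✓`Prop7V0CurrentReality.curV0full_isHermitian_trace_zero_at_record` reused by name.  The sibling v1 `hWR_of_RC_family` (no consumer in the tree) is not twinned.

Cell `ym3-torus`, width seat `ym-ust-19200-w8` (gen 12).  THEOREMS ONLY (0 `def`, 0 `sorry`, 0 `instance`); default heartbeats.  `--supports stmt-QuantumFields-19200 --as helper`, count-neutral.
HONEST SCOPE.  Pass-through twins, no new mathematics; CONDITIONAL on their displayed rows (`hRC`, N06-class, fed by [Balaban1985BackgroundPropagators] Thm 3.12 (3.133) through D11; NOT proved here); nothing of the 13 print rows, `hThm2S`, the stub EX, the crux or rung R3 is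
proved; YM₃ on T³ = rung R3 — NOT d = 4, NOT infinite volume, NOT a mass gap, NOT Clay; the YM gap is NOT proved.

References: T. Bałaban, CMP **102** (1985) 277–309 [Balaban1985Variational] ((90)–(96) pp.291–292, (51) p.286, (14) p.280); CMP **99** (1985) 389–434 [Balaban1985BackgroundPropagators]
((3.7) p.391, p.393, (3.19)–(3.21) pp.393–394).
-/

set_option autoImplicit false

noncomputable section

open scoped InnerProductSpace ComplexConjugate Matrix.Norms.L2Operator BigOperators

namespace Summit.QuantumFields.YangMills.Theorems.Prop7V0CurrentRealityLift

open Literature.MathematicalPhysics.QuantumFieldTheory.Balaban1983to89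
open Literature.MathematicalPhysics.QuantumFieldTheory.Balaban1983to89.T3ContinuumYM3Torus
open Literature.MathematicalPhysics.QuantumFieldTheory.Balaban1983to89.T3Thm1Carrier
open T3SectALandauChart (eta eta_pos)
open T3PrintedRegularMinimiser (RegPr)
open B9SectCLatticeCarrier (Bond)
open B11Eq115Space (NegSup NegSize Space115 JetSup levWeight)
open B11Eq111FrakG (nabla115)
open B11Eq174Chart (Regime solA)
open B11Prop6Scheme (Prop4Hyp)
open B11Eq80Current (Emap W80)
open B11Eq90V0GroupComposed (curV0full curV0full_apply T47 T47_apply fderiv_T47)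
open B11Eq63V0GroupCurrent (curV0)
open B11Eq90V0primeCurrent (Tsh Ucur curL curL_apply curV0prime curV0prime_apply)
open B11Eq96CommutatorCurrent (curComm curComm_apply)
open B11Eq98CurrentSlot (Jcur)
open B11Eq98V0primeCurrentSlots (rieszτ)
open B9Eq3119DeltaPiCarrier (currentCLM)
open B11Eq80CurrentRealSubspace (transCur_apply_mem Emap_apply_mem fderiv_Emap_apply_mem)
open Summit.QuantumFields.YangMills.Theorems.Prop7SectET3Transport (periodsT3 siteEquiv bondEquiv bgOfCfg val_bgOfCfg)
open Summit.QuantumFields.YangMills.Theorems.Prop7SectET3HilbertLetters (W₂ frobEquiv toL2)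
open Summit.QuantumFields.YangMills.Theorems.Prop7SectET3CurvedPropagators (H1f)
open Summit.QuantumFields.YangMills.Theorems.Prop7SectET3WilsonHessian (DeltaEtaSlot)
open Summit.QuantumFields.YangMills.Theorems.Prop7SectET3DeltaPiPInv (DeltaPiSlotP DeltaPiP_isSymmetric)
open Summit.QuantumFields.YangMills.Theorems.Prop7SymAvgTwSym (CmapTwS Ctilde_add_central_of_regPr)
open Summit.QuantumFields.YangMills.Theorems.Prop7SectET3JcurReality (val_inv_eq_star_of_mem_su2)
open Summit.QuantumFields.YangMills.Theorems.Prop7HfRealityTrace (H1f_isHermitian_traceless_at_regPr)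
open Summit.QuantumFields.YangMills.Theorems.Prop7SectET3RealityPInv (DeltaPiSlotP_toL2_star_of_regPr trace_DeltaPiSlotP_toL2_eq_zero_of_regPr)
open Summit.QuantumFields.YangMills.Theorems.Prop7SectET3WCurrentProp4Rows (prop4Hyp_CmapTwS_conj_zeroJet)
open Summit.QuantumFields.YangMills.Theorems.Prop7SectET3WCurrentRealityLetters (hτS_trace hτZ_trace hρ_rieszτ_frobEquiv Ctilde_isHermitian_trace_zero_of_ball)
open Summit.QuantumFields.YangMills.Theorems.Prop7SectET3WCurrentReality (fderiv_Emap_apply_eq_zero_of_translate)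
open Summit.QuantumFields.YangMills.Theorems.Prop7SectET3WCurrentRealityClosed (W80_isHermitian_trace_zero_at_record_closed)
open Summit.QuantumFields.YangMills.Theorems.Prop7V0CurrentCentralDeriv (dV0primeBond_apply_smul_one_eq_zero dTerm39Bond_apply_smul_one_eq_zero)
open Summit.QuantumFields.YangMills.Theorems.Prop7V0CurrentHermitianReality (conj_dV0primeBond_apply conj_dTerm39Bond_apply)
open Summit.QuantumFields.YangMills.Theorems.Prop7V0CurrentReality (curV0full_isHermitian_trace_zero_at_record)

/-- ★★★ **SED-TWIN T1∕D12 (a) (LIFT-THREAD 2): THE FAMILY ROW `hV0` FROM `hRC`, UNDER THE `Lift L i U₀` ANTECEDENT** — v1 ✓`Prop7V0CurrentReality.hV0_of_RC_family` with the opaque predicate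
binder `Lift` and the token `Lift L i U₀ →` after `RegPr … (α L) U₀ →` in the consumed row `hRC` and in the conclusion (convention (α)(β)(γ)); proof = v1's with `hLift` passed through.
CONDITIONAL on `hRC` (not proved).
[cite: Balaban1985Variational, (90)–(96) pp.291–292, (51) p.286, (14) p.280; Balaban1985BackgroundPropagators, (3.7) p.391, p.393, (3.19)–(3.21) pp.393–394] -/
theorem hV0_of_RC_family
    [hFL : ∀ F : T3Family, Fact (0 < (F.L : ℝ))] [hFη : ∀ (F : T3Family) (k : ℕ), Fact (0 < ((F.L : ℝ)⁻¹) ^ k)]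
    (Lift : ∀ (L : ℕ) (i : Idx L), GaugeField (i.1.1.P i.1.2.2) 0 (Matrix.specialUnitaryGroup (Fin 2) ℂ) → Prop)
    (α a₃ ef εC bH : ℕ → ℝ) (hα : ∀ L, 1 < L → 0 < α L) (hef : ∀ L, 1 < L → 0 < ef L)
    (hWe : ∀ L : ℕ, 1 < L → 10 ^ 9 * (L : ℝ) ^ 2 * ef L ≤ 1) (hWε : ∀ L : ℕ, 1 < L → 10 ^ 12 * (L : ℝ) ^ 3 * α L ≤ 1)
    (c₀ cB : ℕ → ℝ) [hc₀ : ∀ L : ℕ, Fact (0 < c₀ L)] [hcB : ∀ L : ℕ, Fact (0 < cB L)]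
    (a : ∀ L : ℕ, Idx L → ℝ) (ha : ∀ (L : ℕ) (i : Idx L), 0 < a L i)
    (hRC : ∀ (L : ℕ), 1 < L → ∀ (i : Idx L) (U₀ : GaugeField (i.1.1.P i.1.2.2) 0 (Matrix.specialUnitaryGroup (Fin 2) ℂ)), RegPr i.1.1 i.1.2.1 i.1.2.2 (α L) U₀ → Lift L i U₀ →
      Regime (H1f i.1.1 i.1.2.1 i.1.2.2 i.2.2.le (c₀ L) (cB L) (a L i) (DeltaPiSlotP i.1.1 i.1.2.1 i.1.2.2 i.2.2.le (c₀ L) (cB L) (a L i)) U₀) 0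
        (fun A' : Space115 (i.1.1.L : ℝ) (((i.1.1.L : ℝ)⁻¹) ^ (i.1.2.2 - i.1.2.1)) (fun _ : Bond 3 (periodsT3 i.1.1 i.1.2.2) => i.1.2.2 - i.1.2.1)
            (fun _ : Bond 3 (periodsT3 i.1.1 i.1.2.2) × Fin 3 => i.1.2.2 - i.1.2.1) (nabla115 (((i.1.1.L : ℝ)⁻¹) ^ (i.1.2.2 - i.1.2.1)) (bgOfCfg i.1.1 i.1.2.2 U₀)) =>
          (-Complex.I) • CmapTwS i.1.1 i.1.2.1 i.1.2.2 i.2.2.le U₀ (((((eta i.1.1 i.1.2.1 i.1.2.2 : ℝ) : ℂ)) * Complex.I) • (fun b : PBond (i.1.1.P i.1.2.2) 0 => JetSup.equiv _ _ _ A' (bondEquiv i.1.1 i.1.2.2 b))))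
        (bH L) 0 (40 * (2 * (3 * (2 * ef L + 2700 * (L : ℝ) * α L))) / ef L ^ 2) (ef L / 2) 0 (a₃ L) (εC L)) :
    ∀ (L : ℕ), 1 < L → ∀ (i : Idx L) (U₀ : GaugeField (i.1.1.P i.1.2.2) 0 (Matrix.specialUnitaryGroup (Fin 2) ℂ)), RegPr i.1.1 i.1.2.1 i.1.2.2 (α L) U₀ → Lift L i U₀ →
      ∀ A : Space115 (i.1.1.L : ℝ) (((i.1.1.L : ℝ)⁻¹) ^ (i.1.2.2 - i.1.2.1)) (fun _ : Bond 3 (periodsT3 i.1.1 i.1.2.2) => i.1.2.2 - i.1.2.1)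
          (fun _ : Bond 3 (periodsT3 i.1.1 i.1.2.2) × Fin 3 => i.1.2.2 - i.1.2.1) (nabla115 (((i.1.1.L : ℝ)⁻¹) ^ (i.1.2.2 - i.1.2.1)) (bgOfCfg i.1.1 i.1.2.2 U₀)),
        ‖A‖ < a₃ L → (∀ b, (JetSup.equiv _ _ _ A b).IsHermitian ∧ (JetSup.equiv _ _ _ A b).trace = 0) →
        ∀ b, (NegSup.equiv _ _ (curV0full (rieszτ frobEquiv) (LinearMap.toContinuousLinearMap (Matrix.traceLinearMap (Fin 2) ℂ ℂ)) (bgOfCfg i.1.1 i.1.2.2 U₀)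
              (H1f i.1.1 i.1.2.1 i.1.2.2 i.2.2.le (c₀ L) (cB L) (a L i) (DeltaPiSlotP i.1.1 i.1.2.1 i.1.2.2 i.2.2.le (c₀ L) (cB L) (a L i)) U₀)
              (fun A' => (-Complex.I) • CmapTwS i.1.1 i.1.2.1 i.1.2.2 i.2.2.le U₀ (((((eta i.1.1 i.1.2.1 i.1.2.2 : ℝ) : ℂ)) * Complex.I) • (fun b : PBond (i.1.1.P i.1.2.2) 0 => JetSup.equiv _ _ _ A' (bondEquiv i.1.1 i.1.2.2 b))))
              (εC L) A) b).IsHermitian ∧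
          (NegSup.equiv _ _ (curV0full (rieszτ frobEquiv) (LinearMap.toContinuousLinearMap (Matrix.traceLinearMap (Fin 2) ℂ ℂ)) (bgOfCfg i.1.1 i.1.2.2 U₀)
              (H1f i.1.1 i.1.2.1 i.1.2.2 i.2.2.le (c₀ L) (cB L) (a L i) (DeltaPiSlotP i.1.1 i.1.2.1 i.1.2.2 i.2.2.le (c₀ L) (cB L) (a L i)) U₀)
              (fun A' => (-Complex.I) • CmapTwS i.1.1 i.1.2.1 i.1.2.2 i.2.2.le U₀ (((((eta i.1.1 i.1.2.1 i.1.2.2 : ℝ) : ℂ)) * Complex.I) • (fun b : PBond (i.1.1.P i.1.2.2) 0 => JetSup.equiv _ _ _ A' (bondEquiv i.1.1 i.1.2.2 b))))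
              (εC L) A) b).trace = 0 := by
  intro L hL i U₀ hreg hLift A hA hAS b
  have hLi : (L : ℝ) = (i.1.1.L : ℝ) := by rw [i.2.1]
  have hWe' : 10 ^ 9 * (i.1.1.L : ℝ) ^ 2 * ef L ≤ 1 := by rw [← hLi]; exact hWe L hL
  have hWε' : 10 ^ 12 * (i.1.1.L : ℝ) ^ 3 * α L ≤ 1 := by rw [← hLi]; exact hWε L hL
  have hRC' := hRC L hL i U₀ hreg hLift
  rw [hLi] at hRC'
  exact curV0full_isHermitian_trace_zero_at_record i.1.1 i.1.2.1 i.1.2.2 i.2.2.le (c₀ L) (cB L) (a L i) (ha L i).le (hα L hL) (hef L hL) hWe' hWε' U₀ hreg hRC'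
    A hA hAS b

end Summit.QuantumFields.YangMills.Theorems.Prop7V0CurrentRealityLift

end
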